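import Summits.QuantumFields.QCD.Theses.RenormalisedVafaWitten
import Literature.MathematicalPhysics.QuantumFieldTheory.QCDFlavourSymmetry
import Summits.QuantumFields.QCD.Theorems.PauliWegnerSeaChiralGluonicCompletionStubLatticeGapTwoDegenerateOfNeutral
import HarnessLib.Audit

/-!
# Birth skeleton (BC3) for the crux `GapFromLineShield` (item stmt-QuantumFields-8694)

Route `RenormalisedVafaWitten` (sub-problem QCD), crux decl
`Summit.QuantumFields.QCD.Theses.RenormalisedVafaWitten.GapFromLineShield` (rank 3, rev 11; used by the route's
deciding theorem `closes` at `M₀ = 0`):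

  `∀ N_f reg M₀, N_f ∈ {2,3} → reg.HasMassScaling → (admissibility: ∀ m > 0, ∃ z shift T, IsQCDAlong (reg.scheme m z
     shift) T ∧ ∀ f ≠ g, T.IsNontrivial (pseudoRe f g)) → 0 ≤ M₀ → (renormalised WINDOW SHIELD above M₀: ∀ M̄ ∃ c > 0,
     ∀ m ∈ (M₀, M̄]^{N_f}, ∀ f ≠ g, ∃ C, ∀ᶠ k, ∀ S ≥ L_k, ∀ n ≤ S, ‖⟨P_fg(0) P_gf(n e₀)⟩_{k,S}‖ ≤ C e^{−c((m_f−M₀)+(m_g−M₀)) a_k n})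
     → ∀ m > M₀, ∀ z shift T, IsQCDAlong (reg.scheme m z shift) T → ∃ Δ > 0, T.HasMassGap Δ ∧ (reg.scheme m z shift).HasLatticeMassGap Δ`.

Registered by the skeleton-registrar seat `planner-skel-stmt-QuantumFields-8694-0` (route re-audit bin REPAIRABLE,
2026-08-17) as `Cruxes/GapFromLineShield/Lines/birth.lean`.  It is the route-level BIRTH CERTIFICATE of the crux (≥ 2
named stubs, a kernel-checked composition concluding the crux BY NAME, `sorry` only inside `stub_*`), deliberately
LINE-NEUTRAL, and it cuts the crux along the route's OWN mechanism — the QUANTUM-NUMBER CUT of the lattice gap ("every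
cross-contracted quark line decays by the shield; what is left is clustering of the unquenched gauge marginal on
line-disconnected functionals", route header) — in the only form the tree can type today, by FLAVOUR SECTOR (the
vector flavour torus of `QCDFlavourSymmetry.lean`, exact at all masses), plus the transfer to the continuum gap:

* `stub_neutralSectorGap : Stmt.stub_neutralSectorGap` (open-problem, Millennium-grade; the route header's
  GaugeMarginalClustering node in sector form) — under the crux's hypotheses, at every tuple `m > M₀` the lattice
  theories of `reg` have a uniform gap `Δ₀(m) > 0` on the FLAVOUR-NEUTRAL sector,
  `(reg.scheme m 0 0).HasNeutralLatticeMassGap Δ₀` (tree notion: the body of `HasLatticeMassGap` restricted to pairs of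
  flavour-neutral observables — Wilson loops, `ψ̄_f Γ ψ_f`, neutral products).  After the quark-line split of a neutral
  pair this is (a) k,S-uniform clustering of the unquenched (for `N_f = 3` signed) `SU(3)` gauge marginal on
  line-disconnected functionals (Wilson loops, hairpins `tr Γ D⁻¹(x,x)`) — the Yang–Mills-type core — and (b) the
  flavour-DIAGONAL twin of the shield for the neutral valence-connected lines (`π⁰`-type channels).
* `stub_chargedSectorShield : Stmt.stub_chargedSectorShield` (size L / open; the route-specific WEINGARTEN EXTENSION
  of the shield) — under the same hypotheses, at every `m > M₀` there is `Δc(m) > 0` such that EVERY pair `(A, B)` with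
  `A` of definite non-zero flavour multi-charge decays at rate `Δc a_k` uniformly (`HasChargedLatticeDecay`, verbatim
  the charged hypothesis of the landed sector reduction).  A charged pair is purely cross-contracted (`⟨A⟩ = 0` by the
  exact selection rule `qcdTorusExpect_eq_zero_of_fermiFlavourScale`), carried by ≥ 2 valence lines of net flavour
  `q` (colour-singlet ⇒ `∑_f q_f ∈ 3ℤ`); configuration-wise every such diagram is dominated through γ₅-hermiticity by
  products of `|G_f|²`, i.e. by pseudoscalar-channel integrands (Weingarten 1983: `m_X ≥ m_π`, `m_B ≥ m_π`), so the
  window shield's rate for the flavours carried bounds the whole charged sector, `Δc(m) ≍ 2 c(M̄) min_f (m_f − M₀)`,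
  `M̄ = max_f m_f`.
* `stub_gapInheritance : Stmt.stub_gapInheritance` (size M/L; VERBATIM the statement registered for the sibling
  cruxes `MassiveBridge`, `InfiniteVolumePackageC`, `SeaThreshold` — one shared lemma of all QCD packages) — for every
  scheme `sch`, OS data `T` and `Δ > 0`: `IsQCDAlong sch T` and `sch.HasLatticeMassGap Δ` give some `Δ' ∈ (0, Δ]` with
  `T.HasMassGap Δ'` (the route header's "transfer-matrix bookkeeping from operator-norm-uniform lattice decay to
  `T.HasMassGap`": uniform lattice clustering passes to the limits on off-diagonal real tensors, a total set for the OS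
  reconstruction of `T`; Laplace-transform / spectral-measure upgrade, Glimm–Jaffe Thm 6.1.3 / §19).

`GapFromLineShield_of : Stmt.stub_neutralSectorGap → Stmt.stub_chargedSectorShield → Stmt.stub_gapInheritance →
GapFromLineShield` is kernel-checked and its seam is NOT trivial: neutral gap `Δ₀` ⊕ charged decay `Δc` give the FULL
uniform lattice gap `min Δ₀ Δc` by the LANDED reduction
`Summit.QuantumFields.QCD.Theorems.StronglyChiralSubsequence.hasLatticeMassGap_of_neutral_of_charged` (any `N_f`, any
scheme: flavour-weight decomposition of both observables into finitely many charge components commuting with the gauge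
action, bi-additivity of the connected correlation, the selection rule for the mixed terms, a finite sum of constants —
file `Theorems/PauliWegnerSeaChiralGluonicCompletionStubLatticeGapTwoDegenerateOfNeutral.lean`, sorry-free); the
lattice clause is moved to the data's own scheme `reg.scheme m z shift` (it reads only `β_k, m_f(k), L_k, a_k` —
`hasLatticeMassGap_scheme_iff`, `Iff.rfl`); S3 gives a continuum rate `Δ' ≤ min Δ₀ Δc`; the lattice gap is weakened to
the common rate `Δ'` (`hasLatticeMassGap_mono`).  `gapFromLineShield_of_stubs : GapFromLineShield` instantiates it.

Naming (for `ledger skeleton check` / `#h21_check_skeleton`, hypotheses admissible only BY NAME): the statement of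
the registered stub `stub_<name>` is `def Stmt.stub_<name> : Prop`, so every hypothesis of `GapFromLineShield_of` is
headed by a constant whose short name IS a declared stub (device of `Cruxes/SeaThreshold/Lines/birth.lean`).

## Negative knowledge honoured (read 2026-08-17)
* `Cruxes/GapFromLineShield/` had NO workfiles before this one (`ledger crux ls`: none; no `Disproof.lean`, no dead
  lines, no crux ideas, hence no `_false_without_` obstruction to honour); the crux's evidence is the route-repair
  planner's `Sketch.lean` (`closes`, p117723) and the grounder/refuter stamps (checked_at 2026-08-15, grounded_at
  2026-08-16).
* `ledger negatives --problem QuantumFields` (5 entries: RobustYangMillsRG stmt-14958 — a wild blocking map inhabits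
  an under-constrained admissibility predicate; MirrorModularBoosts stmt-9665; AdaptiveCoarseSystem stmt-9494 — a
  hand-picked-constants ∃-package; MultibosonLatticeGap stmt-9599 — an unsatisfiable root-list admissibility clause;
  AdmissibleRootsExist stmt-9603).  Lesson applied: NO bespoke predicate is introduced — every stub is phrased over the
  Statement's / the crux's own vocabulary (`IsQCDAlong`, `HasMassScaling`, `HasLatticeMassGap`, `HasMassGap`, the
  crux's verbatim admissibility and window-shield clauses) and the tree's flavour-sector vocabulary
  (`HasNeutralLatticeMassGap`, `flavourScale`); no stub is an instance of a refuted statement.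
* Junk witnesses: the vacuum data with `z ≡ 0` inhabit `IsQCDAlong` (`isQCDAlong_zeroAF_vacuum`) and every `HasMassGap`
  (`vacuum_hasMassGap`), so S3's vacuum instance is true; in S1/S2 a vanishing twisted partition function makes every
  `qcdTorusExpect` the junk `0`, for which hypothesis (shield) AND conclusions hold together — no vacuous refutation.
* Typing checklist 4c: no Bochner integral over a free function is introduced (the only `∫` sit inside the tree's
  `qcdTorusExpect`, copied verbatim from the crux), no hand-picked threshold or rate (`Δ₀, Δc, Δ, Δ'` existential),
  no determinantal / complex-action positivity claim (the sign problem is named as S2's failure mode, not assumed away).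

## BC3 probes (planner folder `bc/`): for each stub statement `S`, `S → GapFromLineShield` and `S → QCD` by
`first | exact? | simpa | aesop` FAIL (files `bc/probe_<stub>.lean`; rc and goals in NOTES.md and `Lines/birth.md`).
-/

noncomputable section

namespace Summit.QuantumFields.QCD.Cruxes.GapFromLineShield.Birth

open scoped BigOperators Topology Classical
open MeasureTheory Filter
open Literature.Probability.LatticeModels Literature.MathematicalPhysics.QuantumLattice
open Literature.MathematicalPhysics.QuantumFieldTheory
open Summit.QuantumFields.QCD.Theses.RenormalisedVafaWitten

/-! ## §0 Currency (the Statement's and the crux's vocabulary only) -/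

/-- **Admissibility data of `reg`** (verbatim the crux's third hypothesis): for every POSITIVE tuple `m` there are
species renormalisations `z, shift` and OS data `T` with `IsQCDAlong (reg.scheme m z shift) T` whose flavour-changing
pseudoscalars `Re ψ̄_f iγ₅ ψ_g`, `f ≠ g`, are not c-numbers (quarks propagate). -/
def Admissible (Nf : ℕ) (reg : QCDRegularisation Nf) : Prop :=
  ∀ m : Fin Nf → ℝ, (∀ f, 0 < m f) →
    ∃ (z shift : QCDField Nf → ℕ → ℝ) (T : OSData (QCDField Nf) 4),
      IsQCDAlong (reg.scheme m z shift) T ∧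
        ∀ f g : Fin Nf, f ≠ g → T.IsNontrivial (QCDField.pseudoRe f g)

/-- **The renormalised quark-line WINDOW SHIELD above `M₀`** (verbatim the crux's fifth hypothesis): on every mass
window `(M₀, M̄]` there is a rate constant `c > 0` such that for all tuples `m` in the window and all `f ≠ g` the
flavour-changing pseudoscalar two-point function `⟨P_fg(0) P_gf(n e₀)⟩_{k,S}` (torus expectation at `β_k` and bare
masses `m_crit(k) + a_k m/Z_m(k)`; `⟨P_fg⟩ = 0` by flavour symmetry, so this IS the connected function) decays at the
renormalised rate `c((m_f − M₀) + (m_g − M₀)) a_k` per Euclidean time step, eventually in `k`, on every torus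
`2S+1 ≥ 2L_k+1`, for all `n ≤ S`. -/
def WindowShieldAbove (Nf : ℕ) (reg : QCDRegularisation Nf) (M₀ : ℝ) : Prop :=
  ∀ Mbar : ℝ, ∃ c : ℝ, 0 < c ∧ ∀ m : Fin Nf → ℝ, (∀ f, M₀ < m f ∧ m f ≤ Mbar) → ∀ f g : Fin Nf, f ≠ g →
    ∃ C : ℝ, ∀ᶠ k in atTop, ∀ S : ℕ, reg.L k ≤ S → ∀ n : ℕ, n ≤ S →
      ‖qcdTorusExpect (reg.β k) (2 * S + 1) (fun fl => reg.mcrit k + reg.a k * m fl / reg.Zm k)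
          (fun _ => pseudoscalarBilinear f g (0 : TorusSite 4 (2 * S + 1)) *
            pseudoscalarBilinear g f (fun i : Fin 4 => if i = 0 then ((n : ℕ) : ZMod (2 * S + 1)) else 0))‖ ≤
        C * Real.exp (-(c * ((m f - M₀) + (m g - M₀)) * (reg.a k * n)))

/-- **Uniform decay at rate `Δc` of the FLAVOUR-CHARGED sector of the lattice theory along `sch`** (verbatim the
charged hypothesis of the landed sector reduction `hasLatticeMassGap_of_neutral_of_charged`): for every pair `(A, B)` of
gauge-invariant local lattice QCD observables whose first member carries a definite NON-ZERO flavour multi-charge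
`q ∈ ℤ^{N_f}` under the vector flavour torus (`t · A = (∏_f t_f^{q_f}) A` for all `t ∈ (ℂˣ)^{N_f}`: flavoured mesons
`ψ̄_f Γ ψ_g`, `f ≠ g`, baryons, …) there is `C` with `‖⟨A · τ_{n e₀}B⟩_{k,S} − ⟨A⟩⟨B⟩‖ ≤ C e^{−Δc a_k n}` for all large
`k`, every torus `2S+1 ≥ 2L_k+1` and all `n ≤ S` (`B` arbitrary: only its charge-`−q` component talks to `A`). -/
def HasChargedLatticeDecay {Nf : ℕ} (sch : QCDScheme Nf) (Δc : ℝ) : Prop :=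
  ∀ (R R' : ℕ) (A : QCDLatticeObservable Nf R) (B : QCDLatticeObservable Nf R'),
    (∃ q : Fin Nf → ℤ, q ≠ 0 ∧ ∀ t : Fin Nf → ℂ, (∀ f, t f ≠ 0) → ∀ U,
        QCDLatticeObservable.flavourScale t (A.F U) = (∏ f, t f ^ q f) • A.F U) →
      ∃ C : ℝ, ∀ᶠ k in atTop, ∀ S : ℕ, sch.L k ≤ S → ∀ n : ℕ, n ≤ S →
        ‖qcdLatticeConnectedCorr (sch.β k) (2 * S + 1) (fun fl => sch.mq fl k) A B n‖ ≤
          C * Real.exp (-(Δc * (sch.a k * n)))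

/-! ## §1 The three stub statements

Naming (for `ledger skeleton check` / `#h21_check_skeleton`): the statement of the registered stub `stub_<name>` is the
`def Stmt.stub_<name> : Prop` below, so that every hypothesis of the composition `GapFromLineShield_of` is headed by a
constant whose short name IS a declared stub.  Prose names: (S1) NeutralSectorGap / (S2) ChargedSectorShield /
(S3) GapInheritance. -/

/-- **(S1) Neutral-sector uniform lattice gap from the line shield** (the route header's node GaugeMarginalClustering
in flavour-sector form; open-problem, Millennium-grade).  For `N_f ∈ {2,3}`, every regularisation `reg` with
`HasMassScaling` and admissibility data, every `M₀ ≥ 0` above which the renormalised window shield holds: at every tuple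
`m` with all `m_f > M₀` the lattice theories of `reg` (bare trajectory `m_crit(k) + a_k m_f/Z_m(k)`; the clause reads
only `β_k, m_f(k), L_k, a_k`, whence `z = shift = 0`) have a uniform gap `Δ₀ > 0` on the FLAVOUR-NEUTRAL sector:
connected Euclidean-time correlations of ALL pairs of flavour-neutral gauge-invariant local observables (Wilson loops,
`ψ̄_f Γ ψ_f`, neutral products of mesons and baryons) decay at rate `Δ₀ a_k`, eventually in `k`, on every torus
`2S+1 ≥ 2L_k+1`, uniformly in `S` (`HasNeutralLatticeMassGap`).  Why plausibly true: with the flavoured channels massive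
at rate `∝ (m_f − M₀)` (the shield excludes the Aoki fingers and the chiral point eventually in `k`), the neutral sector
of massive QCD is gapped by `min(m_{π⁰}, m_glueball, 2m_π) > 0`; after the quark-line split of a neutral pair the
line-disconnected part is the covariance of two bounded quasi-local gauge functionals (Wilson loops, hairpin loops)
under ONE signed, quasi-locally perturbed pure-gauge measure — the input format of a robust Yang–Mills engine — and the
neutral valence-connected part is the flavour-diagonal twin of the shield (γ₅-hermiticity: `tr G_f G_f†` is the
`⟨P_fg P_gf⟩` integrand at `m_g = m_f`).  Why it might fail: Millennium-grade — k,S-uniform clustering of the unquenched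
`SU(3)` gauge marginal on Wilson-loop and hairpin functionals is the Yang–Mills mass gap plus a non-local (for `N_f = 3`
signed) fermionic weight; nothing bridges Bałaban's small-field UV regime to confinement scales
(`Δ ∝ e^{−1/(2b₀g₀²)}`, PT-invisible); the `(−1)^F`-twisted finite-torus functional needs vacuum dominance; the
flavour-diagonal valence lines are covered by the `f ≠ g` hypothesis only at degenerate tuples (a different measure).
Size: open-problem.  Leans on: JaffeWitten2000 §5, OsterwalderSeiler1978, Seiler1982 Ch. 3, Balaban1989LargeFieldII,
MagnenRivasseauSeneor1993, tree `QCDScheme.HasNeutralLatticeMassGap`. -/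
def Stmt.stub_neutralSectorGap : Prop :=
  ∀ (Nf : ℕ) (reg : QCDRegularisation Nf) (M₀ : ℝ), (Nf = 2 ∨ Nf = 3) → reg.HasMassScaling →
    Admissible Nf reg → 0 ≤ M₀ → WindowShieldAbove Nf reg M₀ →
      ∀ m : Fin Nf → ℝ, (∀ f, M₀ < m f) →
        ∃ Δ₀ : ℝ, 0 < Δ₀ ∧ (reg.scheme m 0 0).HasNeutralLatticeMassGap Δ₀

/-- **(S2) Charged-sector shield — the Weingarten extension of the pseudoscalar line bound** (route-specific; size
L / open).  Under the same hypotheses, at every tuple `m` with all `m_f > M₀` there is `Δc > 0` such that every pair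
`(A, B)` of gauge-invariant local lattice QCD observables with `A` of definite non-zero flavour multi-charge has its
connected Euclidean-time correlation bounded by `C e^{−Δc a_k n}`, eventually in `k`, on every torus `2S+1 ≥ 2L_k+1`,
`n ≤ S` (`HasChargedLatticeDecay (reg.scheme m 0 0) Δc`).  Why plausibly true: a charged pair is purely cross-contracted
— `⟨A⟩ = 0` by the exact vector-flavour selection rule (tree `qcdTorusExpect_eq_zero_of_fermiFlavourScale`), and gauge
invariance forces `∑_f q_f ∈ 3ℤ`, so at least two valence lines of net flavour `q` run from `A` to `τ_{n e₀}B`; by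
γ₅-hermiticity every such diagram is dominated configuration-wise by products of `|G_f(0,x)|²`, the pseudoscalar
integrands (Weingarten's inequalities `m_X ≥ m_π` for flavour-non-singlet mesons, `m_B ≥ m_π` for baryons), so the
window shield on `(M₀, M̄]`, `M̄ = max_f m_f`, bounds the whole charged sector at `Δc ≍ 2c(M̄) min_f (m_f − M₀)`.  Why it
might fail: (i) for `N_f = 3` (and a mass-split doublet) the unquenched weight is signed, and configuration-wise
domination does not integrate (`|E[sign·X]| ≤ E[|X|]` is not `≤ C·E[sign·|G|²]`) — the route's own ⟨sign⟩⁻¹ objection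
at the level of this stub; (ii) the hypothesis controls `⟨P_fg P_gf⟩`, `f ≠ g`, only: domination of `tr(Γ G_g Γ' G_f†)`
lands on flavour-DIAGONAL squares `|G_f|²` at the same tuple, which the hypothesis covers only at degenerate tuples
(another measure) — a comparison-in-the-mass step is needed; (iii) point-split observables (`R > 0`) and baryons need
the constants to survive the quark box; (iv) `P_fg Ω` must overlap the lightest charged state for the spectral
reading.  Size: L / open.  Leans on: Weingarten1983, VafaWitten1984NPB, MontvayMunster1994 §5.1.1 (5.6), tree
`QCDFlavourSymmetry` (`flavourScale`, selection rule), tree `FermiFlavourPhase`. -/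
def Stmt.stub_chargedSectorShield : Prop :=
  ∀ (Nf : ℕ) (reg : QCDRegularisation Nf) (M₀ : ℝ), (Nf = 2 ∨ Nf = 3) → reg.HasMassScaling →
    Admissible Nf reg → 0 ≤ M₀ → WindowShieldAbove Nf reg M₀ →
      ∀ m : Fin Nf → ℝ, (∀ f, M₀ < m f) →
        ∃ Δc : ℝ, 0 < Δc ∧ HasChargedLatticeDecay (reg.scheme m 0 0) Δc

/-- **(S3) Continuum gap inheritance** (clustering + OS reconstruction; size M/L; VERBATIM the statement registered
for the sibling cruxes `MassiveBridge` (S3), `InfiniteVolumePackageC` (S3), `SeaThreshold` (S3) — one shared lemma).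
For every scheme `sch`, OS data `T` and rate `Δ > 0`: if `T` is QCD along `sch` (all lattice `n`-point functions of the
species fields converge to `T`'s Schwinger functions on off-diagonal real tensors) and the lattice theories of `sch` have
the uniform full-spectrum lattice gap `Δ`, then `T` has a mass gap `Δ'` for some `0 < Δ' ≤ Δ` (`T.HasMassGap Δ'`:
uniform exponential clustering of ALL truncated Schwinger functions of `T`, i.e. `σ(H) ⊆ {0} ∪ [Δ', ∞)`, `0` simple,
on the full OS space of `T`).  Why plausibly true: the smeared species fields are finite sums of translates of local
lattice observables, so their connected Euclidean-time correlations inherit the lattice decay in physical units; the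
bound passes to the `k → ∞` limits on off-diagonal real tensors, a total set for the OS reconstruction of `T`
(Schwinger functions are continuous linear functionals, only their `⁰𝒮` values matter); a Laplace-transform argument
on spectral measures upgrades clustering on a total set to the spectral gap (Glimm–Jaffe Thm 6.1.3, §19).  Why it
might fail (as typed): the constants of `HasLatticeMassGap` are per pair, not uniform over the `O(a_k⁻⁴)` spatial
translates entering a smeared field (the renormalisations `z_s(k)` grow polynomially in `a_k⁻¹`); the scheme's
functional is the finite-torus `(−1)^F`-twisted trace at side `2L_k+1` with `a_k L_k → ∞` at NO prescribed speed — the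
honest route is the transfer-matrix spectral bound at each `k` (Lüscher's positive transfer matrix, `m_f(k) > −1`
from `IsQCDAlong`) plus vacuum dominance as `a_k L_k → ∞`.  Size: M/L.  Leans on: GlimmJaffe1987 Thm 6.1.3 / §19,
OsterwalderSchrader1975 Thm E→R, Luscher1977, tree `OSData.HasMassGap`, `vacuum_hasMassGap`. -/
def Stmt.stub_gapInheritance : Prop :=
  ∀ (Nf : ℕ) (sch : QCDScheme Nf) (T : OSData (QCDField Nf) 4) (Δ : ℝ),
    IsQCDAlong sch T → 0 < Δ → sch.HasLatticeMassGap Δ →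
      ∃ Δ' : ℝ, 0 < Δ' ∧ Δ' ≤ Δ ∧ T.HasMassGap Δ'

/-! ## §2 The registered stubs (the ONLY `sorry`s of this file) -/

/-- (S1) neutral-sector uniform lattice gap from the line shield — open-problem (Millennium-grade). -/
theorem stub_neutralSectorGap : Stmt.stub_neutralSectorGap := by
  sorry

/-- (S2) charged-sector shield (Weingarten extension of the pseudoscalar line bound) — size L / open. -/
theorem stub_chargedSectorShield : Stmt.stub_chargedSectorShield := by
  sorry

/-- (S3) continuum gap inheritance through OS reconstruction — size M/L. -/
theorem stub_gapInheritance : Stmt.stub_gapInheritance := by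
  sorry

/-! ## §3 Composition (kernel-checked; no `sorry` below this line) -/

/-- The lattice gap clause of a regularisation's scheme does not read the species renormalisations `z, shift`
(only `β_k, m_f(k), L_k, a_k`): definitional. [folklore] -/
theorem hasLatticeMassGap_scheme_iff {Nf : ℕ} (reg : QCDRegularisation Nf) (m : Fin Nf → ℝ)
    (z shift : QCDField Nf → ℕ → ℝ) (Δ : ℝ) :
    (reg.scheme m z shift).HasLatticeMassGap Δ ↔ (reg.scheme m 0 0).HasLatticeMassGap Δ :=
  Iff.rfl

/-- **Monotonicity of the uniform lattice gap in the rate**: a lattice gap `Δ` is a lattice gap `Δ' ≤ Δ`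
(the constant is replaced by `max C 0`; `a_k n ≥ 0`). [folklore] -/
theorem hasLatticeMassGap_mono {Nf : ℕ} (sch : QCDScheme Nf) {Δ Δ' : ℝ}
    (h : sch.HasLatticeMassGap Δ) (hle : Δ' ≤ Δ) : sch.HasLatticeMassGap Δ' := by
  intro R R' A B
  obtain ⟨C, hC⟩ := h R R' A B
  refine ⟨max C 0, ?_⟩
  filter_upwards [hC] with k hk S hS n hn
  have h1 := hk S hS n hn
  have han : 0 ≤ sch.a k * (n : ℝ) := mul_nonneg (sch.a_pos k).le (Nat.cast_nonneg n)
  have hexp : Real.exp (-(Δ * (sch.a k * n))) ≤ Real.exp (-(Δ' * (sch.a k * n))) :=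
    Real.exp_le_exp.2 (by nlinarith)
  exact h1.trans ((mul_le_mul_of_nonneg_right (le_max_left C 0) (Real.exp_pos _).le).trans
    (mul_le_mul_of_nonneg_left hexp (le_max_right C 0)))

/-- **Neutral gap ⊕ charged decay ⇒ full uniform lattice gap** at the common rate — the LANDED sector reduction
(`StronglyChiralSubsequence.hasLatticeMassGap_of_neutral_of_charged`: flavour-weight decomposition of both
observables, bi-additivity of the connected correlation, selection rule for the mixed terms, finite sum of constants;
any `N_f`, any scheme), restated in this file's currency. [folklore] -/
theorem hasLatticeMassGap_of_sectors {Nf : ℕ} (sch : QCDScheme Nf) {Δ₀ Δc : ℝ}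
    (hN : sch.HasNeutralLatticeMassGap Δ₀) (hC : HasChargedLatticeDecay sch Δc) :
    sch.HasLatticeMassGap (min Δ₀ Δc) :=
  Summit.QuantumFields.QCD.Theorems.StronglyChiralSubsequence.hasLatticeMassGap_of_neutral_of_charged sch hN hC

/-- **The crux from the three stubs** (concludes `GapFromLineShield` BY NAME).  Fix the data of the crux and a tuple
`m > M₀` with its `(z, shift, T)`, `IsQCDAlong (reg.scheme m z shift) T`.  S1 gives a neutral-sector rate `Δ₀`, S2 a
charged-sector rate `Δc`, the landed reduction the full lattice gap `min Δ₀ Δc` of `reg.scheme m 0 0`, moved to the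
data's own scheme by `hasLatticeMassGap_scheme_iff`; S3 gives a continuum rate `Δ' ≤ min Δ₀ Δc` with `T.HasMassGap Δ'`,
and the lattice gap is weakened to the common rate `Δ'` by `hasLatticeMassGap_mono`. -/
theorem GapFromLineShield_of :
    Stmt.stub_neutralSectorGap → Stmt.stub_chargedSectorShield → Stmt.stub_gapInheritance →
      Summit.QuantumFields.QCD.Theses.RenormalisedVafaWitten.GapFromLineShield := by
  intro hN hC hI
  unfold Summit.QuantumFields.QCD.Theses.RenormalisedVafaWitten.GapFromLineShield
  intro Nf reg M₀ hNf hms hadm hM₀ hshield m hm z shift T hqcd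
  obtain ⟨Δ₀, hΔ₀, hneu⟩ := hN Nf reg M₀ hNf hms hadm hM₀ hshield m hm
  obtain ⟨Δc, hΔc, hch⟩ := hC Nf reg M₀ hNf hms hadm hM₀ hshield m hm
  have hlat₀ : (reg.scheme m 0 0).HasLatticeMassGap (min Δ₀ Δc) := hasLatticeMassGap_of_sectors _ hneu hch
  have hlat : (reg.scheme m z shift).HasLatticeMassGap (min Δ₀ Δc) :=
    (hasLatticeMassGap_scheme_iff reg m z shift _).2 hlat₀
  obtain ⟨Δ', hΔ', hle, hT⟩ := hI Nf (reg.scheme m z shift) T (min Δ₀ Δc) hqcd (lt_min hΔ₀ hΔc) hlat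
  exact ⟨Δ', hΔ', hT, hasLatticeMassGap_mono _ hlat hle⟩

/-- The crux along this skeleton, from the registered stubs (sorries only inside `stub_*`). -/
theorem gapFromLineShield_of_stubs :
    Summit.QuantumFields.QCD.Theses.RenormalisedVafaWitten.GapFromLineShield :=
  GapFromLineShield_of stub_neutralSectorGap stub_chargedSectorShield stub_gapInheritance

end Summit.QuantumFields.QCD.Cruxes.GapFromLineShield.Birth

end
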